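import Summits.CriticalPhenomena.SAWScalingLimit.Theorems.SAWDevelopingMapObservableToSLETypeLadderCarvedReductionSqueezeLimitCover
import Literature.Probability.RandomPlanarGeometry.JordanDomainInterior
import Literature.Probability.RandomPlanarGeometry.JordanDomainProofs
import HarnessLib

/-!
# The limit bulk `Ω`: windows, far part, connected complement, inside the super-domain
# (piece (T-A′₂ bulk) of stub T-A′₂ `stub_carvedReduction_squeezeGeometry_domainsCore`)

Crux `SAWDevelopingMap.ObservableToSLE` (stmt-CriticalPhenomena-10472), line `six-class-type-ladder`,
stub T-A′₂ `stub_carvedReduction_squeezeGeometry_domainsCore`.  Landing target: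
`Summits/CriticalPhenomena/SAWScalingLimit/Theorems/SAWDevelopingMapObservableToSLETypeLadderCarvedReductionSqueezeBulk.lean`.

The bulk of the squeeze is `Ω := connectedComponentIn (Dτ ∖ X) b₀`, `Dτ = D - τ` the translated
target domain, `X` the closed limit structure, `b₀` a window point above the pinned gate `P₀`.
This file turns the four BULK HYPOTHESES of the twin's inner-approximant contract
(`Squeeze.stub_carvedReduction_innerApproximant`, p144792) into elementary inputs:
* `ball_subset_translate_of_subset_closure` — an open ball inside `closure (D - τ)` lies inside
  `D - τ` (Jordan domains are regular open: `JordanDomain.interior_subset_of_frontier_subset_closure`);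
  with `TypeLadder.ball_subset_closure_pinned` this puts the window balls inside `Dτ`;
* `window_subset_bulk`, `window_subset_bulk_of_joinedIn` — a preconnected `X`-free part of `Dτ`
  containing `b₀`, or joined to `b₀` inside `Dτ ∖ X` (the far window: piece BulkPath), lies in `Ω`;
* `exists_mem_bulk_dist_eq`, `subset_bulk_of_mem` — the bulk path crosses every intermediate
  sphere about `α`, so a preconnected `X`-free set through such a point (the no-long-fingers set of
  `Squeeze.noLongFingers_domain`, translated) lies in `Ω`: the far part `Dτ ∖ ⋃ closedBall` is in `Ω`;
* `isConnected_compl_bulk` — `Ωᶜ` is connected as soon as `Dτᶜ ∪ X` is (piece LimitUnion's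
  `isConnected_compl_connectedComponentIn`), and `isConnected_compl_translate_union` — `Dτᶜ ∪ X`
  is connected when `X = XS ∪ XT` with `XS`, `XT` connected through the pinned roots
  `D.pt i - τ ∈ frontier Dτ` (`JordanDomain.isPreconnected_compl`);
* `bulk_subset_of_joinedIn` — `Ω ⊆ E` for the super-domain `E` of `TypeLadder.superSup` (p146087),
  from its `JoinedIn` clause, `Dτ ⊆ J` and `cuts ∩ Dτ ⊆ X`.
Registered carrier: `stub_carvedReduction_bulk`.
-/

noncomputable section

open scoped Topology
open Filter Set Metric
open Literature.Probability.RandomPlanarGeometry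

namespace Summit.CriticalPhenomena.SAWScalingLimit.Theorems.ObservableToSLE.TypeLadder

/-! ### Translates of a Jordan domain -/

section Translate

variable (D : JordanDomain) (τ : ℂ)

/-- The translation `z ↦ z - τ` as a homeomorphism. -/
theorem sub_eq_addRight : (fun z : ℂ => z - τ) = (Homeomorph.addRight (-τ) : ℂ → ℂ) := by
  ext z; simp [sub_eq_add_neg]

/-- The closure of the translate is the translate of the closure. -/
theorem closure_translate : closure ((fun z : ℂ => z - τ) '' D.carrier) = (fun z : ℂ => z - τ) '' closure D.carrier := by
  rw [sub_eq_addRight]; exact ((Homeomorph.addRight (-τ)).image_closure D.carrier).symm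

/-- The frontier of the translate is the translate of the frontier. -/
theorem frontier_translate : frontier ((fun z : ℂ => z - τ) '' D.carrier) = (fun z : ℂ => z - τ) '' frontier D.carrier := by
  rw [sub_eq_addRight]; exact ((Homeomorph.addRight (-τ)).image_frontier D.carrier).symm

/-- The translate is open. -/
theorem isOpen_translate : IsOpen ((fun z : ℂ => z - τ) '' D.carrier) := by
  rw [sub_eq_addRight]; exact (Homeomorph.addRight (-τ)).isOpenMap _ D.isOpen

/-- The complement of the translate is preconnected (`JordanDomain.isPreconnected_compl`). -/
theorem isPreconnected_compl_translate : IsPreconnected ((fun z : ℂ => z - τ) '' D.carrier)ᶜ := by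
  rw [sub_eq_addRight, ← (Homeomorph.addRight (-τ)).image_compl]
  exact D.isPreconnected_compl.image _ (Homeomorph.addRight (-τ)).continuous.continuousOn

/-- The pinned marked point `D.boundary t - τ` lies outside the (open) translate. -/
theorem boundary_sub_not_mem_translate (t : ℝ) : D.boundary t - τ ∉ (fun z : ℂ => z - τ) '' D.carrier := by
  rintro ⟨w, hw, hwt⟩
  have : w = D.boundary t := by linear_combination hwt
  subst this
  exact (Set.disjoint_left.1 D.disjoint_carrier_frontier hw) (D.boundary_mem_frontier t)

/-- **An open ball inside the closure of the translate lies inside the translate** (Jordan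
domains are regular open). -/
theorem ball_subset_translate_of_subset_closure {c : ℂ} {r : ℝ}
    (h : ball c r ⊆ closure ((fun z : ℂ => z - τ) '' D.carrier)) : ball c r ⊆ (fun z : ℂ => z - τ) '' D.carrier := by
  -- translate back: `ball (c + τ) r ⊆ closure D`
  have h1 : ball (c + τ) r ⊆ closure D.carrier := by
    intro w hw
    have hw' : w - τ ∈ ball c r := by
      rw [mem_ball] at hw ⊢; rw [dist_eq_norm] at hw ⊢
      simpa [sub_sub, add_comm] using hw
    obtain ⟨u, hu, hut⟩ := (closure_translate D τ) ▸ h hw'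
    have : u = w := by linear_combination hut
    exact this ▸ hu
  have hfr : frontier (ball (c + τ) r) ⊆ closure D.carrier :=
    (frontier_subset_closure).trans ((closure_mono h1).trans (by rw [closure_closure]))
  have h2 := (D.interior_subset_of_frontier_subset_closure isBounded_ball hfr).1
  rw [interior_eq_iff_isOpen.2 isOpen_ball] at h2
  intro z hz
  refine ⟨z + τ, h2 ?_, by ring⟩
  rw [mem_ball, dist_eq_norm] at hz ⊢
  simpa using hz

end Translate

/-! ### The bulk: windows and the far part -/

section Bulk

variable {G : Set ℂ} {b₀ : ℂ}

/-- **A preconnected subset of `G` containing `b₀` lies in the bulk** (the near window). -/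
theorem window_subset_bulk {W : Set ℂ} (hW : IsPreconnected W) (hWG : W ⊆ G) (hb : b₀ ∈ W) :
    W ⊆ connectedComponentIn G b₀ :=
  hW.subset_connectedComponentIn hb hWG

/-- **A point joined to `b₀` inside `G` lies in the bulk.** -/
theorem mem_bulk_of_joinedIn {z : ℂ} (h : JoinedIn G b₀ z) : z ∈ connectedComponentIn G b₀ := by
  obtain ⟨γ, hγ⟩ := h
  have hsub : range γ ⊆ connectedComponentIn G b₀ :=
    (isPreconnected_range γ.continuous).subset_connectedComponentIn ⟨0, γ.source⟩ (range_subset_iff.2 hγ)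
  exact hsub ⟨1, γ.target⟩

/-- **A preconnected subset of `G` through a point of the bulk lies in the bulk.** -/
theorem subset_bulk_of_mem {W : Set ℂ} (hW : IsPreconnected W) (hWG : W ⊆ G) {z : ℂ} (hzW : z ∈ W)
    (hz : z ∈ connectedComponentIn G b₀) : W ⊆ connectedComponentIn G b₀ := by
  rw [connectedComponentIn_eq hz]
  exact hW.subset_connectedComponentIn hzW hWG

/-- **A preconnected subset of `G` containing a point joined to `b₀` inside `G` lies in the
bulk** (the far window, joined by the bulk path of piece BulkPath). -/
theorem window_subset_bulk_of_joinedIn {W : Set ℂ} (hW : IsPreconnected W) (hWG : W ⊆ G) {b₁ : ℂ}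
    (hb₁ : b₁ ∈ W) (h : JoinedIn G b₀ b₁) : W ⊆ connectedComponentIn G b₀ :=
  subset_bulk_of_mem hW hWG hb₁ (mem_bulk_of_joinedIn h)

/-- **The bulk path crosses every intermediate sphere**: if `b₀` is joined to `b₁` inside `G`
and `dist b₀ α ≤ r ≤ dist b₁ α`, some point of the bulk is at distance exactly `r` from `α`. -/
theorem exists_mem_bulk_dist_eq {b₁ α : ℂ} {r : ℝ} (h : JoinedIn G b₀ b₁) (h₀ : dist b₀ α ≤ r)
    (h₁ : r ≤ dist b₁ α) : ∃ z ∈ connectedComponentIn G b₀, dist z α = r := by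
  obtain ⟨γ, hγ⟩ := h
  have hcont : Continuous fun t : unitInterval => dist (γ t) α := γ.continuous.dist continuous_const
  obtain ⟨t, ht⟩ := mem_range_of_exists_le_of_exists_ge (c := r) hcont
    ⟨0, show dist (γ 0) α ≤ r by rw [γ.source]; exact h₀⟩ ⟨1, show r ≤ dist (γ 1) α by rw [γ.target]; exact h₁⟩
  refine ⟨γ t, ?_, ht⟩
  have hsub : range γ ⊆ connectedComponentIn G b₀ :=
    (isPreconnected_range γ.continuous).subset_connectedComponentIn ⟨0, γ.source⟩ (range_subset_iff.2 hγ)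
  exact hsub ⟨t, rfl⟩

/-- **THE FAR PART LIES IN THE BULK**: if a preconnected `X`-free `U ⊆ Dτ` contains every point of
`Dτ` at distance `r` from `α` (the translated no-long-fingers set), `dist b₀ α ≤ r ≤ dist b₁ α`,
and `b₀`, `b₁` are joined inside `Dτ ∖ X`, then `U` — hence everything it contains — lies in the
bulk. -/
theorem far_subset_bulk {Dτ X U : Set ℂ} (hU : IsPreconnected U) (hUD : U ⊆ Dτ) (hUX : Disjoint U X)
    {α b₁ : ℂ} {r : ℝ} (hfar : ∀ z ∈ Dτ, dist z α = r → z ∈ U) (h : JoinedIn (Dτ \ X) b₀ b₁)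
    (h₀ : dist b₀ α ≤ r) (h₁ : r ≤ dist b₁ α) : U ⊆ connectedComponentIn (Dτ \ X) b₀ := by
  obtain ⟨z, hz, hzr⟩ := exists_mem_bulk_dist_eq h h₀ h₁
  have hzD : z ∈ Dτ := (connectedComponentIn_subset _ _ hz).1
  exact subset_bulk_of_mem hU (fun w hw => ⟨hUD hw, Set.disjoint_left.1 hUX hw⟩) (hfar z hzD hzr) hz

/-! ### The complement of the bulk is connected -/

/-- **A component of an open set with connected complement has connected complement** (plane
topology; proved in piece LimitUnion as `isConnected_compl_connectedComponentIn`, restated here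
over `Dτ ∖ X`). -/
theorem isConnected_compl_bulk {Dτ X : Set ℂ} (hD : IsOpen Dτ) (hX : IsClosed X) (hc : IsConnected (Dτᶜ ∪ X))
    (hcomp : ∀ (O : Set ℂ) (b : ℂ), IsOpen O → IsConnected Oᶜ → IsConnected (connectedComponentIn O b)ᶜ)
    (b : ℂ) : IsConnected (connectedComponentIn (Dτ \ X) b)ᶜ := by
  refine hcomp _ b (hD.sdiff hX) ?_
  rw [compl_sdiff, union_comm]; exact hc

/-- **`Dτᶜ ∪ (XS ∪ XT)` is connected** when `Dτᶜ` is preconnected and nonempty and the two closed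
limit structures `XS`, `XT` are connected and meet `Dτᶜ` (at the pinned roots `D.pt i - τ`). -/
theorem isConnected_compl_union {Dτ XS XT : Set ℂ} (hD : IsPreconnected Dτᶜ) {α₀ α₁ : ℂ}
    (hα₀ : α₀ ∈ Dτᶜ) (hα₁ : α₁ ∈ Dτᶜ) (hS : IsConnected XS) (hT : IsConnected XT) (hα₀S : α₀ ∈ XS)
    (hα₁T : α₁ ∈ XT) : IsConnected (Dτᶜ ∪ (XS ∪ XT)) := by
  refine ⟨⟨α₀, mem_union_left _ hα₀⟩, ?_⟩
  rw [← union_assoc]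
  exact (hD.union α₀ hα₀ hα₀S hS.isPreconnected).union α₁ (mem_union_left _ hα₁) hα₁T hT.isPreconnected

/-! ### The bulk lies in the super-domain -/

/-- **`Ω ⊆ E`**: if `Dτ ⊆ J`, the cuts meet `Dτ` only inside `X`, the base point `b` of the
`JoinedIn` characterisation of `E` (`TypeLadder.superSup`) lies in the bulk, then the bulk, an open
connected hence path-connected set inside `J ∖ cuts`, lies in `E`. -/
theorem bulk_subset_of_joinedIn {Dτ X J Cut E : Set ℂ} (hD : IsOpen Dτ) (hX : IsClosed X) (hDJ : Dτ ⊆ J)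
    (hcut : Cut ∩ Dτ ⊆ X) {b : ℂ} (hb : b ∈ connectedComponentIn (Dτ \ X) b₀)
    (hE : ∀ z : ℂ, JoinedIn (J \ Cut) z b → z ∈ E) : connectedComponentIn (Dτ \ X) b₀ ⊆ E := by
  intro z hz
  have hopen : IsOpen (connectedComponentIn (Dτ \ X) b₀) := (hD.sdiff hX).connectedComponentIn
  have hpc : IsPathConnected (connectedComponentIn (Dτ \ X) b₀) :=
    hopen.isConnected_iff_isPathConnected.1 ⟨⟨z, hz⟩, isPreconnected_connectedComponentIn⟩
  refine hE z ((hpc.joinedIn z hz b hb).mono fun w hw => ?_)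
  have hw' := connectedComponentIn_subset _ _ hw
  exact ⟨hDJ hw'.1, fun hwc => hw'.2 (hcut ⟨hwc, hw'.1⟩)⟩

end Bulk

/-- **Registered carrier `stub_carvedReduction_bulk`** (crux item stmt-CriticalPhenomena-10472,
stub T-A′₂ `stub_carvedReduction_squeezeGeometry_domainsCore`, piece THE LIMIT BULK): an open ball
inside the closure of a translate of a Jordan domain lies inside the translate. -/
theorem stub_carvedReduction_bulk :
    ∀ (D : JordanDomain) (τ c : ℂ) (r : ℝ), ball c r ⊆ closure ((fun z : ℂ => z - τ) '' D.carrier) →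
      ball c r ⊆ (fun z : ℂ => z - τ) '' D.carrier :=
  fun D τ _ _ h => ball_subset_translate_of_subset_closure D τ h

end Summit.CriticalPhenomena.SAWScalingLimit.Theorems.ObservableToSLE.TypeLadder

end
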